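import Literature.Probability.RandomPlanarGeometry.SLETransience
import Literature.Probability.RandomPlanarGeometry.LoewnerInverseCocycle
import Literature.Probability.RandomPlanarGeometry.LoewnerMapProofs
import Literature.Probability.RandomPlanarGeometry.LocalMartingaleProofs
import Literature.Probability.Process.BrownianZeroOne
import HarnessLib

/-!
# Transience of the SLE trace is a zero-one event: Rohde–Schramm's Thm. 7.1 reduced to positive probability

Trunk T-STOCH. The named fact `Literature.Probability.RandomPlanarGeometry.tendsto_norm_sleTrace_atTop`
(`SLE.lean`: for `κ > 0`, almost surely `|γ(t)| → ∞`, `γ = sleTrace κ ω` the chordal SLE_κ trace;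
S. Rohde, O. Schramm, *Basic properties of SLE*, Ann. of Math. 161 (2005), Thm. 7.1, with the
Update p. 911 for `κ = 8`) is assembled in `SLETransience.lean` from the existence of the trace
(Thm. 5.1, [LSW04] Thm. 4.7) and three *almost sure* statements of §7 (the simple-path step for
`κ ≤ 4`, Lemma 7.3 for `4 < κ ≠ 8`, the `κ = 8` Update), through the proved scaling step
`tendsto_norm_sleTrace_atTop_of_notMem_closure` ("a.s. `0 ∉ cl γ[1, ∞)` ⇒ a.s. transient").

This file **proves** that *positive probability suffices*: if SLE_κ is a.s. generated by a curve,

* `Literature.Probability.RandomPlanarGeometry.measure_setOf_tendsto_norm_sleTrace_zero_or_one` — the transience event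
  `{|γ(t)| → ∞}` has probability `0` or `1`;
* `Literature.Probability.RandomPlanarGeometry.tendsto_norm_sleTrace_atTop_iff_measure_ne_zero` — the trace is a.s. transient
  **iff** `P[0 ∉ cl γ[1, ∞)] > 0`;
* `Literature.Probability.RandomPlanarGeometry.tendsto_norm_sleTrace_atTop_of_measure_halfDisc_ne_zero` — in particular it is
  a.s. transient as soon as `P[K₁ ⊇ {z ∈ ℍ : |z| < ε} for some ε > 0] > 0` (Lemma 7.3 with
  positive probability);
* `Literature.Probability.RandomPlanarGeometry.tendsto_norm_sleTrace_atTop_of_forall_measure_ne_zero` — the target fact from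
  `HasSLETrace κ` and `P[0 ∉ cl γ[1, ∞)] > 0` for all `κ > 0`.

This is the zero-one device of Rohde–Schramm's own proof of Lemma 7.3 (p. 910: "By scale
invariance, `δ` does not depend on `t` … By Blumenthal's 0-1 law it therefore follows that
`δ = 1`"), transported from `t → 0⁺` (Blumenthal) to `t → ∞` (Kolmogorov): the remaining §7
inputs of Thm. 7.1 are thereby only needed *with positive probability*.

## The proof

1. **Kolmogorov's zero-one law, shift form** (`IsPreBrownianReal.measure_zero_or_one_of_shift`,
   any pre-Brownian motion `B` with measurable marginals): an event which for every `n : ℕ`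
   coincides a.s. with `{(u ↦ B(n+u) - B(n)) ∈ Sₙ}`, `Sₙ` measurable, has probability `0` or
   `1` — by the weak Markov property (Mathlib `IsPreBrownianReal.indepFun_shift`) it is
   independent of `σ(B_t, t ≤ n)` for all `n`, hence (π-λ, Mathlib `IndepSets.indep`) of
   `σ(B) ∋` (a version of) itself.
2. **Transience is such an event** (`setOf_tendsto_norm_sleTrace_ae_eq`). Deterministic Loewner
   theory for a continuous driving function `W` whose chain is generated by `γ`
   (`Loewner.escapes_shift_iff`): with `V = W(s+·)`, the inverse cocycle
   `f_{s+q} = fₛ ∘ f^V_q` (`Loewner.loewnerInv_add`, `LoewnerInverseCocycle.lean`) gives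
   `f^V_q(V(q) + iy) = gₛ(f_{s+q}(W(s+q) + iy))`, where `f_{s+q}(W(s+q) + iy) → γ(s+q)` as
   `y ↓ 0` (the tip is the boundary limit of `gₜ⁻¹`; Rohde–Schramm Thm. 4.1 / Lawler Prop. 4.31,
   `IsGeneratedByCurve.tendsto_invFunOn_map_seq`, `LoewnerTraceLimit.lean`) and
   `sup_{Hₛ} |gₛ(z) - z| < ∞` (`Loewner.exists_norm_map_sub_self_le`, from the far-field bounds
   of `LoewnerGrowth.lean`, Lawler's Lemma 4.13); translating by `W(s)`
   (`Loewner.loewnerInvAt_add_const`) passes to the increments `W(s+·) - W(s)`. So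
   `|γ(t)| → ∞` iff the *increments after `s`* lie in the countably described, measurable set
   `Loewner.Escapes` (rational times suffice by continuity of `γ`; the functional is made
   measurable on the whole path space through the Bernstein-driver limits of
   `SLEScaleInvariance.lean`, `Loewner.tipApprox`).
3. **Positive probability from scaling** (`tendsto_norm_sleTrace_atTop_of_measure_ne_zero`): as in
   the printed proof of Thm. 7.1 (p. 911) and in `tendsto_norm_sleTrace_atTop_of_notMem_closure`,
   scale invariance of the trace in law (`identDistrib_sleTrace_scale_of_hasSLETrace`,
   Prop. 2.1 (i)) gives `P[∀ m, ∃ s ≥ m, |γ(s)| < N+1] ≤ P[0 ∈ cl γ[1, ∞)] < 1` for every `N`,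
   so `P[|γ(t)| → ∞] > 0`, hence `= 1` by 1.–2. The converse
   (`measure_ne_zero_of_tendsto_norm_sleTrace_atTop`) runs the scaling backwards.

## Mathlib

We USE `ProbabilityTheory.IsPreBrownianReal.indepFun_shift` (weak Markov property),
`ProbabilityTheory.IndepSets.indep` (π-λ), `IndepFun_iff_Indep`, `Indep_iff`,
`MeasurableSpace.generateFrom_iUnion_measurableSet`, `isPiSystem_iUnion_of_monotone`,
`MeasureTheory.StronglyMeasurable.limUnder`, `ProbabilityTheory.IdentDistrib.measure_mem_eq`,
`MeasureTheory.tendsto_measure_iInter_atTop`, `Monotone.measure_iUnion`,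
`prob_compl_eq_one_sub₀`. Mathlib has Kolmogorov's 0-1 law for independent *sequences* of
σ-algebras (`ProbabilityTheory.measure_zero_or_one_of_measurableSet_limsup_atTop`); the shift
form for Brownian increments used here is derived directly from `indepFun_shift`. Mathlib has
no Loewner chains / SLE.

## References

* S. Rohde, O. Schramm, *Basic properties of SLE*, Ann. of Math. 161 (2005) 883–924: Thm. 7.1
  and its proof (pp. 909, 911), proof of Lemma 7.3 (p. 910, the 0-1 argument), Prop. 2.1 (i)
  (scaling), Thm. 4.1 (p. 898), §3 p. 896 (measurability of `f̂ₛ`).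
* G. F. Lawler, *Conformally Invariant Processes in the Plane*, AMS (2005): Lemma 4.13, Rem. 4.9
  (the cocycle `g_{s+t} = g_{s,s+t} ∘ g_s`), Prop. 4.31.
* O. Kallenberg, *Foundations of Modern Probability*, 2nd ed., Springer (2002): Thm. 3.13
  (Kolmogorov's zero-one law), Thm. 13.4 / Thm. 13.5 (Brownian motion, independent increments).
-/

noncomputable section

open Set Filter Topology MeasureTheory ProbabilityTheory Metric Complex
open UpperHalfPlane (upperHalfPlaneSet isOpen_upperHalfPlaneSet)
open scoped NNReal ENNReal

namespace Literature.Probability.RandomPlanarGeometry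

/-! ### Loewner chains: uniform displacement bounds, the shifted and the translated driver -/

namespace Loewner

variable {W : ℝ≥0 → ℝ} {z : ℂ}

/-- **Uniform displacement bound for `gₛ` and `fₛ = gₛ⁻¹`** (continuous driving function): there
is `C` with `|gₛ(z) - z| ≤ C` on `Hₛ` and `|fₛ(w) - w| ≤ C` on `ℍₒ`. Far from the origin both maps
move points by at most `2s/δ` (Lawler's Lemma 4.13, `lt_swallowingTime_of_far`,
`norm_invFunOn_map_sub_self_le`); a point `z ∈ Hₛ` near the origin is either mapped near the
origin, or its image `w` is far and then `|z - w| = |fₛ(w) - w|` is small.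
[cite: Lawler2005, Lemma 4.13] -/
theorem exists_norm_map_sub_self_le (hW : Continuous W) (s : ℝ≥0) :
    ∃ C : ℝ, 0 ≤ C ∧ (∀ z ∈ domain W s, ‖map W s z - z‖ ≤ C) ∧
      ∀ w ∈ upperHalfPlaneSet, ‖loewnerInv W s w - w‖ ≤ C := by
  obtain ⟨M, hM0, hM⟩ := exists_forall_norm_driving_sub_le hW s 0
  obtain ⟨δ, hδ, hδt, hδ1⟩ := exists_delta s one_pos
  set R : ℝ := M + 2 * δ with hR
  have hR0 : 0 ≤ R := by positivity
  have hg : ∀ z ∈ domain W s, ‖map W s z - z‖ ≤ 2 * R + 1 := by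
    intro z hz
    rcases le_or_gt R ‖z‖ with hfar | hnear
    · have h := ((lt_swallowingTime_of_far hW hM hδ hδt (by simpa using hfar)).2 s le_rfl).2
      linarith
    · have hzH : z ∈ upperHalfPlaneSet := domain_subset W s hz
      set w := map W s z with hw
      have hwH : w ∈ upperHalfPlaneSet := mapsTo_map hW s hz
      rcases le_or_gt R ‖w‖ with hwfar | hwnear
      · have h := norm_invFunOn_map_sub_self_le hW hM hδ hδt hwH (by simpa using hwfar)
        have hfw : Function.invFunOn (map W s) (domain W s) w = z := loewnerInv_map hW hz
        rw [hfw] at h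
        rw [norm_sub_rev]
        linarith
      · calc ‖w - z‖ ≤ ‖w‖ + ‖z‖ := norm_sub_le _ _
          _ ≤ 2 * R + 1 := by linarith
  refine ⟨2 * R + 1, by positivity, hg, fun w hw ↦ ?_⟩
  have hw' : 0 < w.im := hw
  have hz : loewnerInv W s w ∈ domain W s := loewnerInv_mem_domain hW s hw'
  have h := hg _ hz
  rwa [map_loewnerInv hW s hw', norm_sub_rev] at h

/-- **The inverse map of the shifted driver `W (s + ·)`** is `gₛ ∘ f_{s+q}` on `ℍₒ` (the inverse
cocycle `f_{s+q} = fₛ ∘ f^{W(s+·)}_q`, `loewnerInv_add`, composed with `gₛ`).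
[cite: Lawler2005, Rem. 4.9] -/
theorem loewnerInv_shift (hW : Continuous W) (s q : ℝ≥0) (hz : 0 < z.im) :
    loewnerInv (fun u ↦ W (s + u)) q z = map W s (loewnerInv W (s + q) z) := by
  rw [loewnerInv_add hW s q hz, map_loewnerInv hW s (im_loewnerInv_pos (continuous_shift W hW s) q hz)]

/-- The backward-flow functional at the shifted driver: `f^{W(s+·)}_q(W(s+q) + iy) =
gₛ(f_{s+q}(W(s+q) + iy))`. [cite: Lawler2005, Rem. 4.9] -/
theorem loewnerInvAt_shift (hW : Continuous W) (s q : ℝ≥0) {y : ℝ} (hy : 0 < y) :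
    loewnerInvAt q y (fun u ↦ W (s + u)) = map W s (loewnerInv W (s + q) ((W (s + q) : ℂ) + I * y)) := by
  rw [loewnerInvAt]
  exact loewnerInv_shift hW s q (by simpa using hy)

/-- **Translation covariance of the inverse map**: `f^{W+a}_t(z + a) = f^W_t(z) + a` on `ℍₒ`
(`IsSolution.add_const`, `swallowingTime_add_const`). [cite: Lawler2005, Ch. 4 §4.1] -/
theorem loewnerInv_add_const (hW : Continuous W) (a : ℝ) (t : ℝ≥0) (hz : 0 < z.im) :
    loewnerInv (fun u ↦ W u + a) t (z + a) = loewnerInv W t z + a := by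
  have hW' : Continuous fun u ↦ W u + a := hW.add continuous_const
  set x := loewnerInv W t z with hx
  have hxd : x ∈ domain W t := loewnerInv_mem_domain hW t hz
  have hxT : (t : WithTop ℝ≥0) < swallowingTime W x := ((mem_domain_iff W t x).1 hxd).2
  have hx0 : x ≠ W 0 := ne_driving_of_lt_swallowingTime hxT
  have hmap : map W t x = z := map_loewnerInv hW t hz
  -- the translated solution
  obtain ⟨g, hg⟩ := exists_isSolution_swallowingTime_holds hW hx0
  have hg' := hg.add_const a
  have hxd' : x + a ∈ domain (fun u ↦ W u + a) t := by
    refine (mem_domain_iff _ t _).2 ⟨?_, ?_⟩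
    · change 0 < (x + (a : ℂ)).im
      simpa using (domain_subset W t hxd : 0 < x.im)
    · rw [swallowingTime_add_const]
      exact hxT
  have hmap' : map (fun u ↦ W u + a) t (x + a) = z + a := by
    rw [map_eq_of_isSolution hW' hg' hxT, ← hmap, map_eq_of_isSolution hW hg hxT]
  have hza : z + (a : ℂ) ∈ upperHalfPlaneSet := by
    change 0 < (z + (a : ℂ)).im
    simpa using hz
  exact invFunOn_map_eq hW' hza hxd' hmap'

/-- Translation covariance of the backward-flow functional:
`loewnerInvAt t y (W + a) = loewnerInvAt t y W + a`. [cite: Lawler2005, Ch. 4 §4.1] -/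
theorem loewnerInvAt_add_const (hW : Continuous W) (a : ℝ) (t : ℝ≥0) {y : ℝ} (hy : 0 < y) :
    loewnerInvAt t y (fun u ↦ W u + a) = loewnerInvAt t y W + a := by
  rw [loewnerInvAt, loewnerInvAt]
  have h := loewnerInv_add_const hW a t (z := (W t : ℂ) + I * y) (by simpa using hy)
  have heq : (((W t + a : ℝ) : ℂ)) + I * y = ((W t : ℂ) + I * y) + a := by
    push_cast
    ring
  rw [heq, h]

/-! ### The escape event of a driving function -/

variable {U : ℝ≥0 → ℝ} {γ : ℝ≥0 → ℂ}

/-- **Measurable version of the approximate tip** `U ↦ f^U_q(U(q) + i/(n+1))`: the limit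
(`limUnder`) of its values at the Bernstein drivers of `U`, a measurable functional of the path
`U` (`StronglyMeasurable.limUnder`), equal to `loewnerInvAt q (1/(n+1)) U` for continuous `U`
(`tendsto_loewnerInvAt_bernDriverFun`). Rohde–Schramm (2005), §3 p. 896 (`f̂ₛ` is measurable
with respect to `σ(ξ(u), u ≤ s)`). [cite: RohdeSchramm2005, §3 p. 896] -/
def tipApprox (n : ℕ) (q : ℝ≥0) (U : ℝ≥0 → ℝ) : ℂ :=
  limUnder atTop fun N : ℕ ↦ loewnerInvAt q ((1 : ℝ) / (n + 1)) (bernDriverFun N q (bernNodes N q U))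

/-- `tipApprox n q` is measurable on the path space `ℝ≥0 → ℝ` (product σ-algebra). [folklore] -/
theorem measurable_tipApprox (n : ℕ) (q : ℝ≥0) : Measurable (tipApprox n q) :=
  (MeasureTheory.StronglyMeasurable.limUnder (l := atTop) fun N ↦
    (measurable_loewnerInvAt_bernDriverFun N q (y := (1 : ℝ) / (n + 1))
      (by positivity)).stronglyMeasurable).measurable

/-- For a continuous driving function, `tipApprox n q U = f^U_q(U(q) + i/(n+1))`. [folklore] -/
theorem tipApprox_eq (hU : Continuous U) (n : ℕ) (q : ℝ≥0) :
    tipApprox n q U = loewnerInvAt q ((1 : ℝ) / (n + 1)) U :=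
  (tendsto_loewnerInvAt_bernDriverFun hU q (by positivity)).limUnder_eq

/-- The **escape event** of a driving function `U`: for every `R`, from some integer time on,
at every rational time `q` the approximate tips `f^U_q(U(q) + i/(n+1))` have modulus `≥ R` for
all large `n`. A countable Boolean combination of measurable conditions on the path `U`
(`measurableSet_escapes`); for the increments `W(s + ·) - W(s)` of a continuous driving function
whose chain is generated by a curve `γ` it is exactly the event `|γ(t)| → ∞`
(`escapes_shift_iff`). [folklore] -/
def Escapes (U : ℝ≥0 → ℝ) : Prop :=
  ∀ R : ℕ, ∃ q₀ : ℕ, ∀ q : ℚ, (q₀ : ℝ) ≤ q →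
    ∀ᶠ n : ℕ in atTop, (R : ℝ) ≤ ‖tipApprox n (q : ℝ).toNNReal U‖

/-- The escape event is a measurable set of paths. [folklore] -/
theorem measurableSet_escapes : MeasurableSet {U : ℝ≥0 → ℝ | Escapes U} := by
  simp only [Escapes, eventually_atTop, setOf_forall]
  refine MeasurableSet.iInter fun R ↦ ?_
  rw [setOf_exists]
  refine MeasurableSet.iUnion fun q₀ ↦ ?_
  rw [setOf_forall]
  refine MeasurableSet.iInter fun q ↦ (MeasurableSet.const _).imp ?_
  rw [setOf_exists]
  refine MeasurableSet.iUnion fun N ↦ ?_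
  rw [setOf_forall]
  refine MeasurableSet.iInter fun n ↦ (MeasurableSet.const _).imp ?_
  exact measurableSet_le measurable_const (measurable_tipApprox n _).norm

/-- **The escape event of the increments is transience of the curve.** Let the chain of the
continuous driving function `W` be generated by `γ` and `s ≥ 0`. Then
`Escapes (W(s + ·) - W(s)) ↔ |γ(t)| → ∞`. By the inverse cocycle and translation covariance,
`f^{W(s+·)-W(s)}_q(· + i/(n+1)) = gₛ(f_{s+q}(W(s+q) + i/(n+1))) - W(s)`, where
`f_{s+q}(W(s+q) + i/(n+1)) → γ(s+q)` (the tip is the boundary limit, Rohde–Schramm Thm. 4.1 /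
Lawler Prop. 4.31, `IsGeneratedByCurve.tendsto_invFunOn_map_seq`) and `gₛ` moves points of `Hₛ`
by at most a constant (`exists_norm_map_sub_self_le`); rational times suffice by continuity of
`γ`. This is the deterministic part of "transience is a tail event of the driving Brownian
motion". [cite: Lawler2005, Rem. 4.9 and Prop. 4.31] -/
theorem escapes_shift_iff (hγ : IsGeneratedByCurve W γ) (hW : Continuous W) (s : ℝ≥0) :
    Escapes (fun u ↦ W (s + u) - W s) ↔ Tendsto (fun t ↦ ‖γ t‖) atTop atTop := by
  obtain ⟨C, -, hgC, -⟩ := exists_norm_map_sub_self_le hW s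
  set a : ℝ := W s with ha
  set V : ℝ≥0 → ℝ := fun u ↦ W (s + u) - W s with hV
  have hVc : Continuous V := (continuous_shift W hW s).sub continuous_const
  -- `z n q := f_{s+q}(W(s+q) + i/(n+1)) → γ(s+q)`
  set z : ℕ → ℝ≥0 → ℂ := fun n q ↦
    loewnerInv W (s + q) ((W (s + q) : ℂ) + I * ((1 : ℝ) / (n + 1) : ℝ)) with hz
  have hz_tend : ∀ q, Tendsto (fun n ↦ z n q) atTop (𝓝 (γ (s + q))) := fun q ↦
    hγ.tendsto_invFunOn_map_seq hW (s + q)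
  have hznorm : ∀ q, Tendsto (fun n ↦ ‖z n q‖) atTop (𝓝 ‖γ (s + q)‖) := fun q ↦
    (continuous_norm.tendsto _).comp (hz_tend q)
  have hz_dom : ∀ n q, z n q ∈ domain W s := fun n q ↦
    domain_antitone W (le_self_add : s ≤ s + q)
      (loewnerInv_mem_domain hW (s + q) (by
        simp only [Complex.add_im, Complex.ofReal_im, Complex.mul_im, Complex.I_re, Complex.I_im,
          Complex.ofReal_re, zero_mul, one_mul, zero_add]
        positivity))
  -- the key identity
  have hkey : ∀ (n : ℕ) (q : ℝ≥0), tipApprox n q V = map W s (z n q) - a := by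
    intro n q
    have hy : (0 : ℝ) < (1 : ℝ) / (n + 1) := by positivity
    have h1 : (fun u ↦ V u + a) = fun u ↦ W (s + u) := funext fun u ↦ by simp [hV, ha]
    have h2 := loewnerInvAt_add_const hVc a q hy
    rw [h1, loewnerInvAt_shift hW s q hy] at h2
    rw [tipApprox_eq hVc, eq_sub_iff_add_eq, ← h2]
  -- norm comparison
  have hdev : ∀ (n : ℕ) (q : ℝ≥0), ‖map W s (z n q) - z n q - a‖ ≤ C + |a| := fun n q ↦
    calc ‖map W s (z n q) - z n q - a‖ ≤ ‖map W s (z n q) - z n q‖ + ‖(a : ℂ)‖ := norm_sub_le _ _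
      _ ≤ C + |a| := by
        rw [Complex.norm_real, Real.norm_eq_abs]
        linarith [hgC _ (hz_dom n q)]
  have hup : ∀ (n : ℕ) (q : ℝ≥0), ‖tipApprox n q V‖ ≤ ‖z n q‖ + (C + |a|) := by
    intro n q
    have h : tipApprox n q V = z n q + (map W s (z n q) - z n q - a) := by rw [hkey]; ring
    rw [h]
    exact (norm_add_le _ _).trans (by linarith [hdev n q])
  have hlow : ∀ (n : ℕ) (q : ℝ≥0), ‖z n q‖ ≤ ‖tipApprox n q V‖ + (C + |a|) := by
    intro n q
    have h : z n q = tipApprox n q V - (map W s (z n q) - z n q - a) := by rw [hkey]; ring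
    rw [h]
    exact (norm_sub_le _ _).trans (by linarith [hdev n q])
  constructor
  · -- escape ⇒ transience
    intro hesc
    rw [tendsto_atTop_atTop]
    intro b
    obtain ⟨R, hR⟩ := exists_nat_ge (b + (C + |a|) + 1)
    obtain ⟨q₀, hq₀⟩ := hesc R
    -- at rational times `q ≥ q₀`
    have hrat : ∀ q : ℚ, (q₀ : ℝ) ≤ q → b + 1 ≤ ‖γ (s + (q : ℝ).toNNReal)‖ := by
      intro q hq
      refine ge_of_tendsto (hznorm _) ?_
      filter_upwards [hq₀ q hq] with n hn
      have := hup n (q : ℝ).toNNReal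
      linarith
    -- at all real times `≥ s + q₀`, by continuity
    refine ⟨s + q₀, fun t ht ↦ ?_⟩
    obtain ⟨u, rfl⟩ : ∃ u, t = s + u := ⟨t - s, (add_tsub_cancel_of_le (le_self_add.trans ht)).symm⟩
    have hu : ((q₀ : ℕ) : ℝ≥0) ≤ u := le_of_add_le_add_left ht
    have hu' : (q₀ : ℝ) ≤ u := by exact_mod_cast hu
    have hclosed : IsClosed {v : ℝ≥0 | b + 1 ≤ ‖γ (s + v)‖} :=
      isClosed_le continuous_const ((hγ.continuous.comp (continuous_const.add continuous_id)).norm)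
    have hmem : u ∈ closure {v : ℝ≥0 | b + 1 ≤ ‖γ (s + v)‖} := by
      rw [Metric.mem_closure_iff]
      intro ε hε
      obtain ⟨q, huq, hqu⟩ := exists_rat_btwn (show (u : ℝ) < u + ε by linarith)
      have hq0 : (0 : ℝ) ≤ q := u.2.trans huq.le
      refine ⟨(q : ℝ).toNNReal, hrat q (hu'.trans huq.le), ?_⟩
      rw [NNReal.dist_eq, Real.coe_toNNReal _ hq0, abs_sub_comm, abs_of_pos (by linarith)]
      linarith
    have h := hclosed.closure_subset hmem
    simp only [mem_setOf_eq] at h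
    linarith
  · -- transience ⇒ escape
    intro htend R
    rw [tendsto_atTop_atTop] at htend
    obtain ⟨T₀, hT₀⟩ := htend ((R : ℝ) + (C + |a|) + 1)
    obtain ⟨q₀, hq₀⟩ := exists_nat_ge (T₀ : ℝ)
    refine ⟨q₀, fun q hq ↦ ?_⟩
    have hq0 : (0 : ℝ) ≤ q := le_trans (Nat.cast_nonneg q₀) hq
    set q' : ℝ≥0 := (q : ℝ).toNNReal with hq'
    have hsq : T₀ ≤ s + q' := by
      have h1 : (T₀ : ℝ) ≤ q' := by
        rw [hq', Real.coe_toNNReal _ hq0]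
        exact hq₀.trans hq
      exact (show T₀ ≤ q' from NNReal.coe_le_coe.1 h1).trans le_add_self
    have hbig := hT₀ _ hsq
    have hev : ∀ᶠ n in atTop, ‖γ (s + q')‖ - 1 < ‖z n q'‖ :=
      (hznorm q').eventually (Ioi_mem_nhds (by linarith))
    filter_upwards [hev] with n hn
    have := hlow n q'
    linarith

end Loewner

/-! ### Transience of the SLE trace is a zero-one event -/

section SLE

variable {κ : ℝ≥0}

/-- The measurable set of paths `p` for which the driving function `√κ p` escapes
(`Loewner.Escapes`). [folklore] -/
def escapeSet (κ : ℝ≥0) : Set (ℝ≥0 → ℝ) :=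
  (fun p u ↦ Real.sqrt κ * p u) ⁻¹' {U | Loewner.Escapes U}

/-- `escapeSet κ` is measurable. [folklore] -/
theorem measurableSet_escapeSet (κ : ℝ≥0) : MeasurableSet (escapeSet κ) :=
  (measurable_pi_lambda _ fun u ↦ (measurable_pi_apply u).const_mul _) Loewner.measurableSet_escapes

/-- **Transience of the SLE_κ trace is a tail event of the Brownian increments**: if SLE_κ is
a.s. generated by a curve, then for every `n : ℕ` the event `{|γ(t)| → ∞}` coincides a.s. with
the event that the increment path `u ↦ B(n + u) - B(n)` lies in the measurable set `escapeSet κ`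
(`Loewner.escapes_shift_iff` applied to `W = √κ B(ω)`, `s = n`). [folklore] -/
theorem setOf_tendsto_norm_sleTrace_ae_eq (hκ : HasSLETrace κ) (n : ℕ) :
    {ω | Tendsto (fun t ↦ ‖sleTrace κ ω t‖) atTop atTop} =ᵐ[Process.preWienerMeasure]
      (fun ω u ↦ Process.brownian ((n : ℝ≥0) + u) ω - Process.brownian (n : ℝ≥0) ω) ⁻¹'
        escapeSet κ := by
  rw [eventuallyEq_set]
  filter_upwards [ae_isGeneratedByCurve_sleTrace hκ] with ω hω
  have h := Loewner.escapes_shift_iff hω (continuous_sleDriving κ ω) (n : ℝ≥0)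
  have hfun : (fun u ↦ Real.sqrt κ * (Process.brownian ((n : ℝ≥0) + u) ω -
      Process.brownian (n : ℝ≥0) ω)) = fun u ↦ sleDriving κ ω (n + u) - sleDriving κ ω n :=
    funext fun u ↦ by simp only [sleDriving, mul_sub]
  simp only [mem_setOf_eq, mem_preimage, escapeSet, hfun]
  exact h.symm

/-- The transience event of the SLE_κ trace is null-measurable (given `HasSLETrace κ`).
[folklore] -/
theorem nullMeasurableSet_setOf_tendsto_norm_sleTrace (hκ : HasSLETrace κ) :
    NullMeasurableSet {ω | Tendsto (fun t ↦ ‖sleTrace κ ω t‖) atTop atTop}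
      Process.preWienerMeasure := by
  have hm : Measurable fun (ω : ℝ≥0 → ℝ) (u : ℝ≥0) ↦
      Process.brownian (((0 : ℕ) : ℝ≥0) + u) ω - Process.brownian ((0 : ℕ) : ℝ≥0) ω :=
    measurable_pi_lambda _ fun u ↦ (Process.measurable_brownian _).sub (Process.measurable_brownian _)
  exact ((hm (measurableSet_escapeSet κ)).nullMeasurableSet).congr
    (setOf_tendsto_norm_sleTrace_ae_eq hκ 0).symm

/-- **Zero-one law for transience of the SLE_κ trace.** If SLE_κ is a.s. generated by a curve,
the event `{|γ(t)| → ∞ as t → ∞}` (`γ = sleTrace κ ω`) has probability `0` or `1`: it is a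
tail event of the increments of the driving Brownian motion (`setOf_tendsto_norm_sleTrace_ae_eq`),
to which Kolmogorov's zero-one law (`IsPreBrownianReal.measure_zero_or_one_of_shift`) applies.
Rohde–Schramm (2005) use the same device at `t → 0⁺` (Blumenthal's law) in the proof of
Lemma 7.3, p. 910. [cite: RohdeSchramm2005, proof of Lemma 7.3 (p. 910)] -/
theorem measure_setOf_tendsto_norm_sleTrace_zero_or_one (hκ : HasSLETrace κ) :
    Process.preWienerMeasure {ω | Tendsto (fun t ↦ ‖sleTrace κ ω t‖) atTop atTop} = 0 ∨
      Process.preWienerMeasure {ω | Tendsto (fun t ↦ ‖sleTrace κ ω t‖) atTop atTop} = 1 :=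
  isPreBrownianReal_brownian.measure_zero_or_one_of_shift
    Process.measurable_brownian (S := fun _ ↦ escapeSet κ) (fun _ ↦ measurableSet_escapeSet κ)
    (setOf_tendsto_norm_sleTrace_ae_eq hκ)

/-- **Rohde–Schramm's Theorem 7.1 reduced to positive probability.** Let SLE_κ be a.s. generated
by a curve (`HasSLETrace κ`). If `0 ∉ cl γ[1, ∞)` with *positive* probability, then almost
surely `|γ(t)| → ∞`. Proof: as in the printed proof of Thm. 7.1 (p. 911), scale invariance of the
trace in law (`identDistrib_sleTrace_scale_of_hasSLETrace`, Prop. 2.1 (i)) applied to the events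
"`|γ(s)| < r` for some `s ≥ t`" gives `P[∀ m, ∃ s ≥ m, |γ(s)| < N + 1] ≤ P[0 ∈ cl γ[1, ∞)] < 1`
for every `N`, whence `P[|γ(t)| → ∞] > 0`; the zero-one law
(`measure_setOf_tendsto_norm_sleTrace_zero_or_one`) upgrades this to `1`. This replaces the
almost sure hypothesis of `tendsto_norm_sleTrace_atTop_of_notMem_closure` by a
positive-probability one. [cite: RohdeSchramm2005, proof of Thm 7.1 (p. 911) and of Lemma 7.3 (p. 910)] -/
theorem tendsto_norm_sleTrace_atTop_of_measure_ne_zero (hκ : HasSLETrace κ)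
    (hpos : Process.preWienerMeasure {ω | (0 : ℂ) ∉ closure (sleTrace κ ω '' Ici 1)} ≠ 0) :
    ∀ᵐ ω ∂Process.preWienerMeasure, Tendsto (fun t ↦ ‖sleTrace κ ω t‖) atTop atTop := by
  haveI : IsProbabilityMeasure Process.preWienerMeasure := Process.isProbabilityMeasure_preWienerMeasure
    (Process.isProjectiveLimit_preWienerMeasure_of Process.exists_isProjectiveLimit_holds)
  set μ : Measure (ℝ≥0 → ℝ) := Process.preWienerMeasure with hμ
  set Φ : (ℝ≥0 → ℝ) → ℝ≥0 → ℂ := fun ω ↦ sleTrace κ ω with hΦ_def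
  have hscale : ∀ {c : ℝ≥0}, c ≠ 0 →
      IdentDistrib (fun ω ↦ sleTrace κ ω) (fun ω t ↦ (c : ℂ) * sleTrace κ ω (t / c ^ 2)) μ μ :=
    fun hc ↦ identDistrib_sleTrace_scale_of_hasSLETrace hκ hc
  have hΦ : AEMeasurable Φ μ := (hscale one_ne_zero).aemeasurable_fst
  have hcont : ∀ᵐ ω ∂μ, Continuous (Φ ω) := by
    filter_upwards [ae_isGeneratedByCurve_sleTrace hκ] with ω hω using hω.continuous
  -- the events `A n = {∃ s ≥ 1, |γ(s)| < 1/(n+1)}` decrease to `{0 ∈ cl γ[1, ∞)}`, of measure `< 1`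
  set A : ℕ → Set (ℝ≥0 → ℝ) := fun n ↦ Φ ⁻¹' nearZeroAfter 1 (1 / ((n : ℝ) + 1)) with hA_def
  have hA_null : ∀ n, NullMeasurableSet (A n) μ := fun n ↦
    hΦ.nullMeasurableSet_preimage (measurableSet_nearZeroAfter _ _)
  have hA_anti : Antitone A := by
    intro m n hmn
    refine preimage_mono (nearZeroAfter_mono 1 ?_)
    have hm1 : (0 : ℝ) < (m : ℝ) + 1 := by positivity
    exact one_div_le_one_div_of_le hm1 (by exact_mod_cast Nat.add_le_add_right hmn 1)
  set Z : Set (ℝ≥0 → ℝ) := {ω | (0 : ℂ) ∉ closure (sleTrace κ ω '' Ici 1)} with hZ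
  have hZeq : (⋂ n, A n) =ᵐ[μ] (Zᶜ : Set (ℝ≥0 → ℝ)) := by
    rw [eventuallyEq_set]
    filter_upwards [hcont] with ω hc
    rw [mem_iInter, mem_compl_iff]
    change (∀ n, ω ∈ A n) ↔ ¬ ((0 : ℂ) ∉ closure (sleTrace κ ω '' Ici 1))
    rw [not_not]
    constructor
    · intro hmem
      rw [Metric.mem_closure_iff]
      intro ε hε
      obtain ⟨n, hn⟩ := exists_nat_one_div_lt hε
      have h := hmem n
      change ω ∈ Φ ⁻¹' nearZeroAfter 1 (1 / ((n : ℝ) + 1)) at h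
      rw [mem_preimage, mem_nearZeroAfter_iff hc] at h
      obtain ⟨s, hs, hlt⟩ := h
      refine ⟨Φ ω s, mem_image_of_mem _ (mem_Ici.2 hs), ?_⟩
      rw [dist_comm, dist_zero_right]
      exact hlt.trans hn
    · intro hmem n
      change ω ∈ Φ ⁻¹' nearZeroAfter 1 (1 / ((n : ℝ) + 1))
      rw [mem_preimage, mem_nearZeroAfter_iff hc]
      rw [Metric.mem_closure_iff] at hmem
      obtain ⟨b, ⟨s, hs, rfl⟩, hdist⟩ := hmem _ (by positivity : (0 : ℝ) < 1 / ((n : ℝ) + 1))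
      rw [dist_comm, dist_zero_right] at hdist
      exact ⟨s, hs, hdist⟩
  have hZnull : NullMeasurableSet Z μ := by
    have h : NullMeasurableSet (Zᶜ : Set (ℝ≥0 → ℝ)) μ :=
      (NullMeasurableSet.iInter hA_null).congr hZeq
    simpa using h.compl
  have hA_inter_lt : μ (⋂ n, A n) < 1 := by
    rw [measure_congr hZeq, prob_compl_eq_one_sub₀ hZnull]
    exact ENNReal.sub_lt_self ENNReal.one_ne_top one_ne_zero hpos
  have hA_tendsto : Tendsto (fun n ↦ μ (A n)) atTop (𝓝 (μ (⋂ n, A n))) :=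
    tendsto_measure_iInter_atTop hA_null hA_anti ⟨0, measure_ne_top μ _⟩
  -- by scaling, `X N = {∀ m, ∃ s ≥ m, |γ(s)| < N + 1}` has measure `≤ μ (A n)` for every `n`
  have hX : ∀ N n : ℕ, μ (⋂ m : ℕ, Φ ⁻¹' nearZeroAfter (m : ℝ≥0) ((N : ℝ) + 1)) ≤ μ (A n) := by
    intro N n
    -- scale `c = (N+1)(n+1)+1`, time `c²`, radius `c/(n+1) ≥ N+1`
    set k : ℕ := (N + 1) * (n + 1) + 1 with hk
    set c : ℝ≥0 := (k : ℝ≥0) with hc_def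
    have hk0 : k ≠ 0 := by omega
    have hc0 : c ≠ 0 := by rw [hc_def]; exact_mod_cast hk0
    have hcR : (c : ℝ) = ((N : ℝ) + 1) * ((n : ℝ) + 1) + 1 := by
      rw [hc_def, NNReal.coe_natCast, hk]; push_cast; ring
    have hn1 : (0 : ℝ) < (n : ℝ) + 1 := by positivity
    have hrad : (N : ℝ) + 1 ≤ (c : ℝ) * (1 / ((n : ℝ) + 1)) := by
      rw [hcR, mul_one_div, le_div_iff₀ hn1]
      linarith
    have htime : c ^ 2 * 1 ≤ ((k ^ 2 : ℕ) : ℝ≥0) := by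
      rw [mul_one, hc_def, Nat.cast_pow]
    calc μ (⋂ m : ℕ, Φ ⁻¹' nearZeroAfter (m : ℝ≥0) ((N : ℝ) + 1))
        ≤ μ (Φ ⁻¹' nearZeroAfter ((k ^ 2 : ℕ) : ℝ≥0) ((N : ℝ) + 1)) :=
          measure_mono (iInter_subset _ (k ^ 2))
      _ ≤ μ (Φ ⁻¹' nearZeroAfter (c ^ 2 * 1) ((c : ℝ) * (1 / ((n : ℝ) + 1)))) :=
          measure_mono (preimage_mono
            ((nearZeroAfter_anti htime _).trans (nearZeroAfter_mono _ hrad)))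
      _ = μ ((fun ω t ↦ (c : ℂ) * sleTrace κ ω (t / c ^ 2)) ⁻¹'
            nearZeroAfter (c ^ 2 * 1) ((c : ℝ) * (1 / ((n : ℝ) + 1)))) :=
          (hscale hc0).measure_mem_eq (measurableSet_nearZeroAfter _ _)
      _ = μ (A n) := by
          refine measure_congr ?_
          filter_upwards [hcont] with ω hω
          exact propext (scale_mem_nearZeroAfter_iff hω hc0)
  have hXle : ∀ N : ℕ, μ (⋂ m : ℕ, Φ ⁻¹' nearZeroAfter (m : ℝ≥0) ((N : ℝ) + 1)) ≤ μ (⋂ n, A n) :=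
    fun N ↦ ge_of_tendsto' hA_tendsto (hX N)
  -- the complement of the transience event `E` is a.s. covered by `⋃ N, X N`
  set E : Set (ℝ≥0 → ℝ) := {ω | Tendsto (fun t ↦ ‖sleTrace κ ω t‖) atTop atTop} with hE
  have hmonoX : Monotone fun N : ℕ ↦ ⋂ m : ℕ, Φ ⁻¹' nearZeroAfter (m : ℝ≥0) ((N : ℝ) + 1) := by
    intro N N' hNN'
    exact iInter_mono fun m ↦ preimage_mono (nearZeroAfter_mono _ (by exact_mod_cast Nat.add_le_add_right hNN' 1))
  have hEc : μ Eᶜ < 1 := by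
    have hsub : ∀ᵐ ω ∂μ, ω ∈ Eᶜ → ω ∈ ⋃ N : ℕ, ⋂ m : ℕ, Φ ⁻¹' nearZeroAfter (m : ℝ≥0) ((N : ℝ) + 1) := by
      filter_upwards [hcont] with ω hc hω
      simp only [hE, mem_compl_iff, mem_setOf_eq, tendsto_atTop_atTop, not_forall, not_exists,
        not_le] at hω
      obtain ⟨b, hb⟩ := hω
      obtain ⟨N, hN⟩ := exists_nat_ge b
      refine mem_iUnion.2 ⟨N, mem_iInter.2 fun m ↦ ?_⟩
      rw [mem_preimage, mem_nearZeroAfter_iff hc]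
      obtain ⟨s, hms, hlt⟩ := hb m
      exact ⟨s, hms, by linarith⟩
    calc μ Eᶜ ≤ μ (⋃ N : ℕ, ⋂ m : ℕ, Φ ⁻¹' nearZeroAfter (m : ℝ≥0) ((N : ℝ) + 1)) :=
          measure_mono_ae hsub
      _ = ⨆ N : ℕ, μ (⋂ m : ℕ, Φ ⁻¹' nearZeroAfter (m : ℝ≥0) ((N : ℝ) + 1)) :=
          hmonoX.measure_iUnion
      _ ≤ μ (⋂ n, A n) := iSup_le hXle
      _ < 1 := hA_inter_lt
  -- zero-one
  have hEnull : NullMeasurableSet E μ := nullMeasurableSet_setOf_tendsto_norm_sleTrace hκ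
  have hE1 : μ E = 1 := by
    have h01 := measure_setOf_tendsto_norm_sleTrace_zero_or_one hκ
    rw [← hμ, ← hE] at h01
    rcases h01 with h0 | h1
    · exfalso
      have : μ Eᶜ = 1 := by rw [prob_compl_eq_one_sub₀ hEnull, h0, tsub_zero]
      exact (lt_irrefl _) (this ▸ hEc)
    · exact h1
  have hEc0 : μ Eᶜ = 0 := by rw [prob_compl_eq_one_sub₀ hEnull, hE1, tsub_self]
  exact mem_ae_iff.2 hEc0

/-- **Converse: almost sure transience forces `0 ∉ cl γ[1, ∞)` with positive probability.**
If a.s. `0 ∈ cl γ[1, ∞)`, then `P[∃ s ≥ 1, |γ(s)| < r] = 1` for every `r > 0`, hence by scale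
invariance in law `P[∃ s ≥ m, |γ(s)| < 1] = 1` for every `m`, i.e. a.s. the trace returns to the
unit disc after every time, which is incompatible with a.s. transience. (The scaling step of the
proof of Thm. 7.1, p. 911, run backwards.) [cite: RohdeSchramm2005, proof of Thm 7.1 (p. 911)] -/
theorem measure_ne_zero_of_tendsto_norm_sleTrace_atTop (hκ : HasSLETrace κ)
    (h : ∀ᵐ ω ∂Process.preWienerMeasure, Tendsto (fun t ↦ ‖sleTrace κ ω t‖) atTop atTop) :
    Process.preWienerMeasure {ω | (0 : ℂ) ∉ closure (sleTrace κ ω '' Ici 1)} ≠ 0 := by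
  haveI : IsProbabilityMeasure Process.preWienerMeasure := Process.isProbabilityMeasure_preWienerMeasure
    (Process.isProjectiveLimit_preWienerMeasure_of Process.exists_isProjectiveLimit_holds)
  set μ : Measure (ℝ≥0 → ℝ) := Process.preWienerMeasure with hμ
  set Φ : (ℝ≥0 → ℝ) → ℝ≥0 → ℂ := fun ω ↦ sleTrace κ ω with hΦ_def
  have hscale : ∀ {c : ℝ≥0}, c ≠ 0 →
      IdentDistrib (fun ω ↦ sleTrace κ ω) (fun ω t ↦ (c : ℂ) * sleTrace κ ω (t / c ^ 2)) μ μ :=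
    fun hc ↦ identDistrib_sleTrace_scale_of_hasSLETrace hκ hc
  have hΦ : AEMeasurable Φ μ := (hscale one_ne_zero).aemeasurable_fst
  have hcont : ∀ᵐ ω ∂μ, Continuous (Φ ω) := by
    filter_upwards [ae_isGeneratedByCurve_sleTrace hκ] with ω hω using hω.continuous
  have hnull : ∀ (t : ℝ≥0) (r : ℝ), NullMeasurableSet (Φ ⁻¹' nearZeroAfter t r) μ := fun t r ↦
    hΦ.nullMeasurableSet_preimage (measurableSet_nearZeroAfter _ _)
  intro h0
  have hcl : ∀ᵐ ω ∂μ, (0 : ℂ) ∈ closure (sleTrace κ ω '' Ici 1) := by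
    filter_upwards [measure_eq_zero_iff_ae_notMem.1 h0] with ω hω
    simpa using hω
  -- a.s. the trace comes within `r` of `0` after time `1`, for every `r > 0`
  have hr : ∀ {r : ℝ}, 0 < r → μ (Φ ⁻¹' nearZeroAfter 1 r) = 1 := by
    intro r hr
    rw [← prob_compl_eq_zero_iff₀ (hnull 1 r), measure_eq_zero_iff_ae_notMem]
    filter_upwards [hcl, hcont] with ω hω hc
    rw [Set.notMem_compl_iff, mem_preimage, mem_nearZeroAfter_iff hc]
    rw [Metric.mem_closure_iff] at hω
    obtain ⟨b, ⟨s, hs, rfl⟩, hdist⟩ := hω r hr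
    rw [dist_comm, dist_zero_right] at hdist
    exact ⟨s, hs, hdist⟩
  -- by scaling, a.s. it comes within `1` of `0` after every time `m`
  have hm : ∀ m : ℕ, μ (Φ ⁻¹' nearZeroAfter (m : ℝ≥0) 1) = 1 := by
    intro m
    set c : ℝ≥0 := (m : ℝ≥0) + 1 with hc_def
    have hc0 : c ≠ 0 := ne_of_gt (by positivity)
    have htime : (m : ℝ≥0) ≤ c ^ 2 * 1 := by
      rw [mul_one, hc_def, ← NNReal.coe_le_coe]
      push_cast
      nlinarith [(Nat.cast_nonneg m : (0 : ℝ) ≤ m)]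
    have hm1 : (0 : ℝ) < (m : ℝ) + 1 := by positivity
    have hrad : (c : ℝ) * (1 / ((m : ℝ) + 1)) ≤ 1 := by
      rw [hc_def]
      push_cast
      rw [mul_one_div, div_self hm1.ne']
    apply le_antisymm prob_le_one
    calc (1 : ℝ≥0∞) = μ (Φ ⁻¹' nearZeroAfter 1 (1 / ((m : ℝ) + 1))) := (hr (by positivity)).symm
      _ = μ ((fun ω t ↦ (c : ℂ) * sleTrace κ ω (t / c ^ 2)) ⁻¹'
            nearZeroAfter (c ^ 2 * 1) ((c : ℝ) * (1 / ((m : ℝ) + 1)))) := by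
          refine measure_congr ?_
          filter_upwards [hcont] with ω hω
          exact propext (scale_mem_nearZeroAfter_iff hω hc0).symm
      _ = μ (Φ ⁻¹' nearZeroAfter (c ^ 2 * 1) ((c : ℝ) * (1 / ((m : ℝ) + 1)))) :=
          ((hscale hc0).measure_mem_eq (measurableSet_nearZeroAfter _ _)).symm
      _ ≤ μ (Φ ⁻¹' nearZeroAfter (m : ℝ≥0) 1) :=
          measure_mono (preimage_mono
            ((nearZeroAfter_anti htime _).trans (nearZeroAfter_mono _ hrad)))
  have hall : ∀ᵐ ω ∂μ, ∀ m : ℕ, ω ∈ Φ ⁻¹' nearZeroAfter (m : ℝ≥0) 1 := by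
    rw [ae_all_iff]
    intro m
    have h0' : μ (Φ ⁻¹' nearZeroAfter (m : ℝ≥0) 1)ᶜ = 0 := (prob_compl_eq_zero_iff₀ (hnull _ _)).2 (hm m)
    filter_upwards [measure_eq_zero_iff_ae_notMem.1 h0'] with ω hω
    simpa using hω
  -- contradiction with transience
  have hfalse : ∀ᵐ ω ∂μ, False := by
    filter_upwards [h, hall, hcont] with ω hω hmem hc
    rw [tendsto_atTop_atTop] at hω
    obtain ⟨t₀, ht₀⟩ := hω 1
    obtain ⟨m, hm0⟩ := exists_nat_ge (t₀ : ℝ)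
    have hmem' := hmem m
    rw [mem_preimage, mem_nearZeroAfter_iff hc] at hmem'
    obtain ⟨s, hs, hlt⟩ := hmem'
    have ht₀m : t₀ ≤ (m : ℝ≥0) := by exact_mod_cast hm0
    have := ht₀ s (ht₀m.trans hs)
    change 1 ≤ ‖Φ ω s‖ at this
    linarith
  exact IsProbabilityMeasure.ne_zero μ (ae_eq_bot.1 (eventually_false_iff_eq_bot.1 hfalse))

/-- **Transience of the SLE_κ trace, characterised.** If SLE_κ is a.s. generated by a curve,
then the trace is a.s. transient iff `0 ∉ cl γ[1, ∞)` with positive probability.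
[cite: RohdeSchramm2005, Thm 7.1 and its proof (p. 911)] -/
theorem tendsto_norm_sleTrace_atTop_iff_measure_ne_zero (hκ : HasSLETrace κ) :
    (∀ᵐ ω ∂Process.preWienerMeasure, Tendsto (fun t ↦ ‖sleTrace κ ω t‖) atTop atTop) ↔
      Process.preWienerMeasure {ω | (0 : ℂ) ∉ closure (sleTrace κ ω '' Ici 1)} ≠ 0 :=
  ⟨measure_ne_zero_of_tendsto_norm_sleTrace_atTop hκ, tendsto_norm_sleTrace_atTop_of_measure_ne_zero hκ⟩

/-- **Lemma 7.3 in positive-probability form suffices** (case `κ > 4` of the printed proof of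
Thm. 7.1): if SLE_κ is a.s. generated by a curve and, with positive probability, the hull `K₁`
contains a half-disc `{z ∈ ℍ : |z| < ε}`, then the trace is a.s. transient (such an `ω` has
`|γ(s)| ≥ ε` for `s ≥ 1`, `Loewner.IsGeneratedByCurve.le_norm_of_subset_hull`).
[cite: RohdeSchramm2005, Lemma 7.3 and proof of Thm 7.1 (p. 911)] -/
theorem tendsto_norm_sleTrace_atTop_of_measure_halfDisc_ne_zero (hκ : HasSLETrace κ)
    (h : Process.preWienerMeasure
      {ω | ∃ ε : ℝ, 0 < ε ∧ {z ∈ upperHalfPlaneSet | ‖z‖ < ε} ⊆ sleHull κ ω 1} ≠ 0) :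
    ∀ᵐ ω ∂Process.preWienerMeasure, Tendsto (fun t ↦ ‖sleTrace κ ω t‖) atTop atTop := by
  refine tendsto_norm_sleTrace_atTop_of_measure_ne_zero hκ fun h0 ↦ h ?_
  have hsub : ∀ᵐ ω ∂Process.preWienerMeasure,
      ω ∈ {ω | ∃ ε : ℝ, 0 < ε ∧ {z ∈ upperHalfPlaneSet | ‖z‖ < ε} ⊆ sleHull κ ω 1} →
        ω ∈ {ω | (0 : ℂ) ∉ closure (sleTrace κ ω '' Ici 1)} := by
    filter_upwards [ae_isGeneratedByCurve_sleTrace hκ] with ω hω hε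
    obtain ⟨ε, hε, hK⟩ := hε
    rw [Metric.mem_closure_iff]
    push Not
    refine ⟨ε, hε, ?_⟩
    rintro _ ⟨s, hs, rfl⟩
    rw [dist_comm, dist_zero_right]
    exact hω.le_norm_of_subset_hull (continuous_sleDriving κ ω) hK hs
  exact le_antisymm ((measure_mono_ae hsub).trans h0.le) bot_le

/-- **The target fact from positive-probability inputs.** `tendsto_norm_sleTrace_atTop`
(Rohde–Schramm Thm. 7.1 with the Update for `κ = 8`) follows from: SLE_κ is a.s. generated by a
curve for every `κ > 0` (Thm. 5.1 and [LSW04] Thm. 4.7; hypothesis `htr`) and, for every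
`κ > 0`, `0 ∉ cl γ[1, ∞)` with positive probability (hypothesis `hpos`; for `κ ≤ 4` the
simple-path step and Lemma 7.2, for `κ > 4` Lemma 7.3, each needed only with positive
probability). [cite: RohdeSchramm2005, Thm 7.1] -/
theorem tendsto_norm_sleTrace_atTop_of_forall_measure_ne_zero
    (htr : ∀ κ : ℝ≥0, 0 < κ → HasSLETrace κ)
    (hpos : ∀ κ : ℝ≥0, 0 < κ →
      Process.preWienerMeasure {ω | (0 : ℂ) ∉ closure (sleTrace κ ω '' Ici 1)} ≠ 0) :
    tendsto_norm_sleTrace_atTop :=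
  fun hκ ↦ tendsto_norm_sleTrace_atTop_of_measure_ne_zero (htr _ hκ) (hpos _ hκ)

end SLE

end Literature.Probability.RandomPlanarGeometry
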